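import Mathlib
import HarnessLib
import Summits.NavierStokesRegularity.NavierStokesRegularity.Theorems.TaylorModelRungThreeSoundnessVectorField
import Summits.NavierStokesRegularity.NavierStokesRegularity.Theorems.TaylorModelRungThreeSoundnessVectorTaylor

/-!
# Route `CompletionRelayChain` — crux `RelayFrontStep` (stmt-NavierStokesRegularity-24850), LINE `window_v2`:
  K-side of `stub_phaseI`, work package K3 (iv)(v) — ONE TIME STEP OF A PSEUDO-FLOW WITH DISTURBANCE

The Phase-I certificate (CERT-SPEC §9, `K-PLAN-stub_phaseI.md`) encloses the 18 block amplitudes of a restarted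
pseudo-flow by Taylor models, one step `[t_m, t_m + h]` at a time.  On the block the pseudo-flow is a curve
`z : ℝ → ι → ℝ` with `|z' − Q(z,z)|_c ≤ Δ_c` (defect + forcing from the outer shells), `Q` the bilinear block field.
This file proves the two ANALYTIC facts about such a curve that the checker's per-step tests rely on, in the
abstract setting of the 23954 vector-step library (`…Theorems.TaylorModelVector`: finite index type `ι`, bundled
bilinear `Q`, boxes `Set.Icc lo hi ⊆ ι → ℝ`, one-sided derivatives within `Icc 0 h`):

* `box_bootstrap` — continuous induction in a box: a curve whose velocity is bounded by `m` (componentwise) AS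
  LONG AS it lies in the box `[L, U]`, started with margin `h·m` from the faces, stays in the box on `[0,h]` and
  moves at most `t·m` (first-exit argument; `0 < m_c` makes the margin strict).
* `pseudo_mem_Icc_of_aprioriTest` — the A PRIORI TEST of §format (1): `|Q y y|_c + Δ_c ≤ M_c` on the box and
  `lo + h·M ≤ z 0 ≤ hi − h·M` confine the pseudo-trajectory to the a priori box on the whole step.
* `abs_quad_sub_quad_le` — the Lipschitz MATRIX of `y ↦ Q y y` on a box from the coefficients
  `q^c_{ab} = Q(e_a,e_b)_c`: `|Q y y − Q y' y'|_c ≤ Σ_{c'} (Σ_b (|q^c_{c'b}| + |q^c_{bc'}|) B_b) |y − y'|_{c'}`.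
* `abs_pseudo_sub_sol_le` — PSEUDO versus EXACT (§format (2), the `dft + frc` inflation and its Gronwall factor
  `grw`): if the exact solution `ψ` of `ψ' = Q(ψ,ψ)` from `z 0` and the pseudo-trajectory both lie in the box, the
  disturbance rate is `≤ R` and the per-component LINEAR BOOTSTRAP TEST `h·(Lm·b + R) ≤ b` holds (all entries of
  `Lm·b + R` positive), then `|z t − ψ t|_c ≤ b_c` on `[0,h]`.
* `abs_pseudo_sub_taylor_le` — the assembled STEP THEOREM: under the a priori test, the rough-enclosure
  existence theorem of the library gives the exact solution in the box, its componentwise Lagrange remainder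
  (`abs_sub_taylor_le_of_mem_Icc`, jets `T` with the Cauchy recursion, `|T y (p+1)|_c ≤ J_c` on the box) and the
  bootstrap give `|z t c − Σ_{k≤p} T (z 0) k c t^k| ≤ J_c t^{p+1} + b_c` for `t ∈ [0,h]`.

These fix the CHECKER SEMANTICS of the inflation columns `dft/frc/grw` of the tables (`PhaseI.StepInfl`): with
`A_c := dft_c + frc_c` (per-step amounts, `R_c = A_c/h`) and `b_c := A_c (1 + grw_c)` the checker tests
`h·Σ_{c'} Lm_{cc'} b_{c'} + A_c ≤ b_c` and positivity.  Pure ODE analysis (folklore: Lohner 1987 §2, Nedialkov–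
Jackson–Corliss 1999 §3 for the a priori enclosure; Gronwall/continuous induction for the defect); MODEL-lattice
bookkeeping (rung TL-M3-R64) — nothing here is a statement about the Navier–Stokes equations; the crux is OPEN.
-/

noncomputable section

-- the summit-side namespace repeats a component by design (single-conjunct summit, D-0017)
set_option linter.dupNamespace false

namespace Summit.NavierStokesRegularity.NavierStokesRegularity.Cruxes.RelayFrontStep.PhaseI

open Set Filter Topology
open Summit.NavierStokesRegularity.NavierStokesRegularity.Theorems.TaylorModelVector

variable {ι : Type*} [Fintype ι] [DecidableEq ι]

/-! ### Continuous induction in a box -/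

omit [Fintype ι] [DecidableEq ι] in
/-- Mean-value step: if the curve lies in the box `[L,U]` on `[0,t]` (`t ≤ h`) and its velocity is bounded by
`m` componentwise while in the box, then `|f t c − f 0 c| ≤ t·m_c`. [folklore] -/
theorem abs_sub_le_of_forall_mem_Icc {f f' : ℝ → ι → ℝ} {h : ℝ}
    (hder : ∀ s ∈ Icc (0:ℝ) h, HasDerivWithinAt f (f' s) (Icc 0 h) s)
    {L U m : ι → ℝ} (hrate : ∀ s ∈ Icc (0:ℝ) h, f s ∈ Icc L U → ∀ c, |f' s c| ≤ m c)
    {t : ℝ} (ht : t ∈ Icc (0:ℝ) h) (hin : ∀ s ∈ Icc (0:ℝ) t, f s ∈ Icc L U) :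
    ∀ c, |f t c - f 0 c| ≤ t * m c := by
  intro c
  have hsub : Icc (0:ℝ) t ⊆ Icc 0 h := Icc_subset_Icc_right ht.2
  have hderc : ∀ s ∈ Icc (0:ℝ) t, HasDerivWithinAt (fun σ => f σ c) (f' s c) (Icc 0 t) s :=
    fun s hs => ((hasDerivWithinAt_pi.1 (hder s (hsub hs))) c).mono hsub
  have hbound : ∀ s ∈ Icc (0:ℝ) t, ‖f' s c‖ ≤ m c := fun s hs => by
    rw [Real.norm_eq_abs]; exact hrate s (hsub hs) (hin s hs) c
  have key := (convex_Icc (0:ℝ) t).norm_image_sub_le_of_norm_hasDerivWithin_le hderc hbound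
    (left_mem_Icc.2 ht.1) (right_mem_Icc.2 ht.1)
  rw [Real.norm_eq_abs, Real.norm_eq_abs, sub_zero, abs_of_nonneg ht.1] at key
  linarith [key]

omit [DecidableEq ι] in
/-- **CONTINUOUS INDUCTION IN A BOX** (first-exit argument): a curve on `[0,h]` with one-sided derivatives,
whose velocity is bounded by `m_c > 0` componentwise as long as it lies in the closed box `[L,U]`, and which
starts with margin `h·m` from every face, stays in the box on `[0,h]` and satisfies `|f t − f 0|_c ≤ t·m_c`.
[folklore] -/
theorem box_bootstrap {f f' : ℝ → ι → ℝ} {h : ℝ}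
    (hder : ∀ s ∈ Icc (0:ℝ) h, HasDerivWithinAt f (f' s) (Icc 0 h) s)
    {L U m : ι → ℝ} (hm : ∀ c, 0 < m c)
    (hrate : ∀ s ∈ Icc (0:ℝ) h, f s ∈ Icc L U → ∀ c, |f' s c| ≤ m c)
    (htest : ∀ c, L c + h * m c ≤ f 0 c ∧ f 0 c + h * m c ≤ U c) :
    ∀ t ∈ Icc (0:ℝ) h, f t ∈ Icc L U ∧ ∀ c, |f t c - f 0 c| ≤ t * m c := by
  -- continuity within `[0,h]`
  have hcont : ∀ s ∈ Icc (0:ℝ) h, ContinuousWithinAt f (Icc 0 h) s :=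
    fun s hs => (hder s hs).continuousWithinAt
  -- it suffices to show confinement on all of `[0,h]`
  suffices hconf : ∀ t ∈ Icc (0:ℝ) h, f t ∈ Icc L U by
    intro t ht
    exact ⟨hconf t ht, abs_sub_le_of_forall_mem_Icc hder hrate ht
      (fun s hs => hconf s ⟨hs.1, hs.2.trans ht.2⟩)⟩
  -- the start point is in the box
  have h0 : ∀ hh : 0 ≤ h, f 0 ∈ Icc L U := fun hh =>
    ⟨fun c => by nlinarith [(htest c).1, hm c], fun c => by nlinarith [(htest c).2, hm c]⟩
  by_contra hcon
  push Not at hcon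
  -- the violation set and its infimum
  set V : Set ℝ := {t | t ∈ Icc (0:ℝ) h ∧ f t ∉ Icc L U} with hV
  obtain ⟨t₁, ht₁, hft₁⟩ := hcon
  have hVne : V.Nonempty := ⟨t₁, ht₁, hft₁⟩
  have hVbdd : BddBelow V := ⟨0, fun t ht => ht.1.1⟩
  have hh : 0 ≤ h := ht₁.1.trans ht₁.2
  set tstar := sInf V with htstar
  have hts0 : 0 ≤ tstar := le_csInf hVne fun t ht => ht.1.1
  have htsh : tstar ≤ h := (csInf_le hVbdd ⟨ht₁, hft₁⟩).trans ht₁.2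
  have htsI : tstar ∈ Icc (0:ℝ) h := ⟨hts0, htsh⟩
  -- before `tstar` the curve is in the box
  have hbefore : ∀ s ∈ Icc (0:ℝ) h, s < tstar → f s ∈ Icc L U := by
    intro s hs hslt
    by_contra hnot
    exact absurd (csInf_le hVbdd ⟨hs, hnot⟩) (not_le.2 hslt)
  -- at `tstar` the curve is in the (closed) box
  have hat : f tstar ∈ Icc L U := by
    rcases eq_or_lt_of_le hts0 with h0eq | hpos
    · rw [← h0eq]; exact h0 hh
    · have hsub : Ico (0:ℝ) tstar ⊆ Icc 0 h := fun s hs => ⟨hs.1, hs.2.le.trans htsh⟩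
      have hcw : ContinuousWithinAt f (Ico 0 tstar) tstar := (hcont tstar htsI).mono hsub
      have hcl : tstar ∈ closure (Ico (0:ℝ) tstar) := by
        rw [closure_Ico hpos.ne]; exact right_mem_Icc.2 hpos.le
      have hmem := hcw.mem_closure_image hcl
      have himg : f '' Ico (0:ℝ) tstar ⊆ Icc L U := by
        rintro _ ⟨s, hs, rfl⟩
        exact hbefore s (hsub hs) hs.2
      exact (isClosed_Icc.closure_subset_iff.2 himg) hmem
  -- hence in the box on `[0, tstar]`, and the mean-value bound puts `f tstar` strictly inside when `tstar < h`
  have hin : ∀ s ∈ Icc (0:ℝ) tstar, f s ∈ Icc L U := by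
    intro s hs
    rcases eq_or_lt_of_le hs.2 with hse | hsl
    · rw [hse]; exact hat
    · exact hbefore s ⟨hs.1, hs.2.trans htsh⟩ hsl
  have hmv := abs_sub_le_of_forall_mem_Icc hder hrate htsI hin
  -- case `tstar = h`: then `h ∈ V`, contradiction with `hat`
  rcases eq_or_lt_of_le htsh with htse | htsl
  · -- every element of V is ≥ tstar = h and ≤ h
    obtain ⟨v, hvV, hvlt⟩ := exists_lt_of_csInf_lt hVne (lt_add_one tstar)
    have hvge : tstar ≤ v := csInf_le hVbdd hvV
    have hveq : v = tstar := le_antisymm (htse ▸ hvV.1.2) hvge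
    exact hvV.2 (hveq ▸ hat)
  · -- case `tstar < h`: strictly inside, so a neighbourhood within `[0,h]` stays in the open box
    have hstrict : ∀ c, L c < f tstar c ∧ f tstar c < U c := by
      intro c
      have h1 := hmv c
      have h2 := (htest c).1
      have h3 := (htest c).2
      have h4 : (h - tstar) * m c > 0 := mul_pos (by linarith) (hm c)
      constructor
      · nlinarith [abs_le.1 h1]
      · nlinarith [abs_le.1 h1]
    have hopen : IsOpen (Set.pi univ fun c => Ioo (L c) (U c)) :=
      isOpen_set_pi finite_univ fun c _ => isOpen_Ioo
    have hmemO : f tstar ∈ Set.pi univ fun c => Ioo (L c) (U c) :=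
      fun c _ => hstrict c
    have hnhds : f ⁻¹' (Set.pi univ fun c => Ioo (L c) (U c)) ∈ 𝓝[Icc 0 h] tstar :=
      (hcont tstar htsI) (hopen.mem_nhds hmemO)
    obtain ⟨δ, hδpos, hδ⟩ := Metric.mem_nhdsWithin_iff.1 hnhds
    obtain ⟨v, hvV, hvlt⟩ := exists_lt_of_csInf_lt hVne (show tstar < tstar + δ by linarith)
    have hvge : tstar ≤ v := csInf_le hVbdd hvV
    have hvball : v ∈ Metric.ball tstar δ := by
      rw [Metric.mem_ball, Real.dist_eq, abs_of_nonneg (by linarith)]; linarith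
    have hvin := hδ ⟨hvball, hvV.1⟩
    have : f v ∈ Icc L U :=
      ⟨fun c => (hvin c (mem_univ c)).1.le, fun c => (hvin c (mem_univ c)).2.le⟩
    exact hvV.2 this

/-! ### The a priori test of one step -/

omit [DecidableEq ι] in
/-- **A PRIORI ENCLOSURE OF THE PSEUDO-TRAJECTORY** (§format test (1)): if `|Q y y|_c + Δ_c ≤ M_c` (`M_c > 0`)
for every `y` in the box `[lo,hi]`, the disturbance of the curve is `≤ Δ` componentwise while it lies in the box,
and `lo + h·M ≤ z 0 ≤ hi − h·M`, then `z t ∈ [lo,hi]` and `|z t − z 0|_c ≤ t·M_c` for all `t ∈ [0,h]`.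
[folklore] -/
theorem pseudo_mem_Icc_of_aprioriTest (Q : (ι → ℝ) →ₗ[ℝ] (ι → ℝ) →ₗ[ℝ] ι → ℝ)
    {z z' : ℝ → ι → ℝ} {h : ℝ}
    (hder : ∀ s ∈ Icc (0:ℝ) h, HasDerivWithinAt z (z' s) (Icc 0 h) s)
    {lo hi Δ M : ι → ℝ}
    (hdist : ∀ s ∈ Icc (0:ℝ) h, z s ∈ Icc lo hi → ∀ c, |z' s c - Q (z s) (z s) c| ≤ Δ c)
    (hQ : ∀ y ∈ Icc lo hi, ∀ c, |Q y y c| + Δ c ≤ M c) (hM : ∀ c, 0 < M c)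
    (htest : ∀ c, lo c + h * M c ≤ z 0 c ∧ z 0 c + h * M c ≤ hi c) :
    ∀ t ∈ Icc (0:ℝ) h, z t ∈ Icc lo hi ∧ ∀ c, |z t c - z 0 c| ≤ t * M c := by
  refine box_bootstrap hder hM (fun s hs hbox c => ?_) htest
  have h1 := hdist s hs hbox c
  have h2 := hQ (z s) hbox c
  have h3 : |z' s c| ≤ |z' s c - Q (z s) (z s) c| + |Q (z s) (z s) c| := by
    have := abs_add_le (z' s c - Q (z s) (z s) c) (Q (z s) (z s) c)
    rwa [sub_add_cancel] at this
  linarith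

omit [Fintype ι] [DecidableEq ι] in
/-- The rough-enclosure hypothesis of `exists_sol_mem_Icc_of_roughEnclosure` (exact flow) follows from the a
priori test of the pseudo-flow (`Δ ≥ 0`): `x₀ + u • Q y y ∈ [lo,hi]` for `y` in the box and `u ∈ [0,h]`.
[folklore] -/
theorem roughEnclosure_of_aprioriTest (Q : (ι → ℝ) →ₗ[ℝ] (ι → ℝ) →ₗ[ℝ] ι → ℝ)
    {x₀ lo hi Δ M : ι → ℝ} {h : ℝ} (hΔ : ∀ c, 0 ≤ Δ c)
    (hQ : ∀ y ∈ Icc lo hi, ∀ c, |Q y y c| + Δ c ≤ M c)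
    (htest : ∀ c, lo c + h * M c ≤ x₀ c ∧ x₀ c + h * M c ≤ hi c) :
    ∀ y ∈ Icc lo hi, ∀ u ∈ Icc (0:ℝ) h, x₀ + u • Q y y ∈ Icc lo hi := by
  intro y hy u hu
  constructor <;> intro c <;> simp only [Pi.add_apply, Pi.smul_apply, smul_eq_mul]
  · have h1 := hQ y hy c
    have h2 := (htest c).1
    have h3 : |u * Q y y c| ≤ h * M c := by
      rw [abs_mul, abs_of_nonneg hu.1]
      exact mul_le_mul hu.2 (by linarith [hΔ c]) (abs_nonneg _) (hu.1.trans hu.2)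
    nlinarith [abs_le.1 h3]
  · have h1 := hQ y hy c
    have h2 := (htest c).2
    have h3 : |u * Q y y c| ≤ h * M c := by
      rw [abs_mul, abs_of_nonneg hu.1]
      exact mul_le_mul hu.2 (by linarith [hΔ c]) (abs_nonneg _) (hu.1.trans hu.2)
    nlinarith [abs_le.1 h3]

/-! ### The Lipschitz matrix of the quadratic field on a box -/

/-- **Lipschitz matrix from the coefficients**: with `q^c_{ab} := Q(e_a,e_b)_c` and `|y_b|, |y'_b| ≤ B_b`,
`|Q y y − Q y' y'|_c ≤ Σ_{c'} (Σ_b (|q^c_{c'b}| + |q^c_{bc'}|)·B_b)·|y_{c'} − y'_{c'}|`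
(from `Q y y − Q y' y' = Q (y−y') y + Q y' (y−y')` and the coordinate expansion). [folklore] -/
theorem abs_quad_sub_quad_le (Q : (ι → ℝ) →ₗ[ℝ] (ι → ℝ) →ₗ[ℝ] ι → ℝ) {B : ι → ℝ} {y y' : ι → ℝ}
    (hy : ∀ b, |y b| ≤ B b) (hy' : ∀ b, |y' b| ≤ B b) (c : ι) :
    |Q y y c - Q y' y' c| ≤
      ∑ c', (∑ b, (|Q (Pi.single c' 1) (Pi.single b 1) c| + |Q (Pi.single b 1) (Pi.single c' 1) c|) * B b)
        * |y c' - y' c'| := by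
  have e : Q y y c - Q y' y' c = Q (y - y') y c + Q y' (y - y') c := by
    have : Q y y - Q y' y' = Q (y - y') y + Q y' (y - y') := by
      rw [map_sub, LinearMap.sub_apply, map_sub]; abel
    have := congrArg (fun v => v c) this
    simpa only [Pi.sub_apply, Pi.add_apply] using this
  rw [e, Q_expand Q (y - y') y c, Q_expand Q y' (y - y') c]
  -- first term: Σ_a Σ_b (y-y')_a y_b q_{ab}
  have h1 : |∑ a, ∑ b, (y - y') a * y b * Q (Pi.single a 1) (Pi.single b 1) c|
      ≤ ∑ a, (∑ b, |Q (Pi.single a 1) (Pi.single b 1) c| * B b) * |y a - y' a| := by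
    refine (Finset.abs_sum_le_sum_abs _ _).trans (Finset.sum_le_sum fun a _ => ?_)
    refine (Finset.abs_sum_le_sum_abs _ _).trans ?_
    rw [Finset.sum_mul]
    refine Finset.sum_le_sum fun b _ => ?_
    rw [abs_mul, abs_mul, Pi.sub_apply]
    have := hy b
    have h0 : 0 ≤ |y a - y' a| := abs_nonneg _
    have h0' : 0 ≤ |Q (Pi.single a 1) (Pi.single b 1) c| := abs_nonneg _
    calc |y a - y' a| * |y b| * |Q (Pi.single a 1) (Pi.single b 1) c|
        ≤ |y a - y' a| * B b * |Q (Pi.single a 1) (Pi.single b 1) c| := by gcongr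
      _ = |Q (Pi.single a 1) (Pi.single b 1) c| * B b * |y a - y' a| := by ring
  -- second term: Σ_a Σ_b y'_a (y-y')_b q_{ab}; swap the sums
  have h2 : |∑ a, ∑ b, y' a * (y - y') b * Q (Pi.single a 1) (Pi.single b 1) c|
      ≤ ∑ b, (∑ a, |Q (Pi.single a 1) (Pi.single b 1) c| * B a) * |y b - y' b| := by
    rw [Finset.sum_comm]
    refine (Finset.abs_sum_le_sum_abs _ _).trans (Finset.sum_le_sum fun b _ => ?_)
    refine (Finset.abs_sum_le_sum_abs _ _).trans ?_
    rw [Finset.sum_mul]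
    refine Finset.sum_le_sum fun a _ => ?_
    rw [abs_mul, abs_mul, Pi.sub_apply]
    have := hy' a
    have h0 : 0 ≤ |y b - y' b| := abs_nonneg _
    have h0' : 0 ≤ |Q (Pi.single a 1) (Pi.single b 1) c| := abs_nonneg _
    calc |y' a| * |y b - y' b| * |Q (Pi.single a 1) (Pi.single b 1) c|
        ≤ B a * |y b - y' b| * |Q (Pi.single a 1) (Pi.single b 1) c| := by gcongr
      _ = |Q (Pi.single a 1) (Pi.single b 1) c| * B a * |y b - y' b| := by ring
  have hsplit : ∑ c', (∑ b, (|Q (Pi.single c' 1) (Pi.single b 1) c| +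
        |Q (Pi.single b 1) (Pi.single c' 1) c|) * B b) * |y c' - y' c'|
      = ∑ a, (∑ b, |Q (Pi.single a 1) (Pi.single b 1) c| * B b) * |y a - y' a|
        + ∑ b, (∑ a, |Q (Pi.single a 1) (Pi.single b 1) c| * B a) * |y b - y' b| := by
    rw [← Finset.sum_add_distrib]
    refine Finset.sum_congr rfl fun c' _ => ?_
    rw [← add_mul, ← Finset.sum_add_distrib]
    congr 1
    exact Finset.sum_congr rfl fun b _ => by ring
  rw [hsplit]
  exact (abs_add_le _ _).trans (add_le_add h1 h2)

/-! ### Pseudo-trajectory versus exact solution -/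

omit [DecidableEq ι] in
/-- **PSEUDO VERSUS EXACT by the per-component linear bootstrap** (§format test (2), the `dft + frc` columns
and their Gronwall factor `grw`): `z` (disturbance rate `≤ R`) and the exact solution `ψ` from `z 0` both lie in
the box on `[0,h]`, `Lm ≥ 0` is a Lipschitz matrix of `y ↦ Q y y` there, and `b` passes `h·(Lm b + R)_c ≤ b_c` with
`(Lm b + R)_c > 0`; then `|z t − ψ t|_c ≤ t·(Lm b + R)_c ≤ b_c` on `[0,h]`. [folklore] -/
theorem abs_pseudo_sub_sol_le (Q : (ι → ℝ) →ₗ[ℝ] (ι → ℝ) →ₗ[ℝ] ι → ℝ)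
    {z z' ψ : ℝ → ι → ℝ} {h : ℝ}
    (hder : ∀ s ∈ Icc (0:ℝ) h, HasDerivWithinAt z (z' s) (Icc 0 h) s)
    (hψ : ∀ s ∈ Icc (0:ℝ) h, HasDerivWithinAt ψ (Q (ψ s) (ψ s)) (Icc 0 h) s) (hψ0 : ψ 0 = z 0)
    {lo hi R : ι → ℝ} (hzbox : ∀ s ∈ Icc (0:ℝ) h, z s ∈ Icc lo hi)
    (hψbox : ∀ s ∈ Icc (0:ℝ) h, ψ s ∈ Icc lo hi)
    (hdist : ∀ s ∈ Icc (0:ℝ) h, ∀ c, |z' s c - Q (z s) (z s) c| ≤ R c)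
    {Lm : ι → ι → ℝ} (hLm : ∀ c c', 0 ≤ Lm c c')
    (hLip : ∀ y ∈ Icc lo hi, ∀ y' ∈ Icc lo hi, ∀ c,
      |Q y y c - Q y' y' c| ≤ ∑ c', Lm c c' * |y c' - y' c'|)
    {b : ι → ℝ} (hpos : ∀ c, 0 < ∑ c', Lm c c' * b c' + R c)
    (htest : ∀ c, h * (∑ c', Lm c c' * b c' + R c) ≤ b c) :
    ∀ t ∈ Icc (0:ℝ) h, ∀ c, |z t c - ψ t c| ≤ t * (∑ c', Lm c c' * b c' + R c) := by
  -- the difference curve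
  have hderD : ∀ s ∈ Icc (0:ℝ) h,
      HasDerivWithinAt (fun σ => z σ - ψ σ) (z' s - Q (ψ s) (ψ s)) (Icc 0 h) s :=
    fun s hs => (hder s hs).sub (hψ s hs)
  have hrate : ∀ s ∈ Icc (0:ℝ) h, (fun σ => z σ - ψ σ) s ∈ Icc (-b) b →
      ∀ c, |(z' s - Q (ψ s) (ψ s)) c| ≤ ∑ c', Lm c c' * b c' + R c := by
    intro s hs hin c
    have e : (z' s - Q (ψ s) (ψ s)) c
        = (z' s c - Q (z s) (z s) c) + (Q (z s) (z s) c - Q (ψ s) (ψ s) c) := by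
      simp only [Pi.sub_apply]; ring
    rw [e]
    refine (abs_add_le _ _).trans ?_
    have h1 := hdist s hs c
    have h2 := hLip (z s) (hzbox s hs) (ψ s) (hψbox s hs) c
    have h3 : ∑ c', Lm c c' * |z s c' - ψ s c'| ≤ ∑ c', Lm c c' * b c' := by
      refine Finset.sum_le_sum fun c' _ => mul_le_mul_of_nonneg_left ?_ (hLm c c')
      have hl := hin.1 c'
      have hu := hin.2 c'
      simp only [Pi.sub_apply, Pi.neg_apply] at hl hu
      exact abs_le.2 ⟨by linarith, hu⟩
    linarith
  have htest' : ∀ c, (-b) c + h * (∑ c', Lm c c' * b c' + R c) ≤ (fun σ => z σ - ψ σ) 0 c ∧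
      (fun σ => z σ - ψ σ) 0 c + h * (∑ c', Lm c c' * b c' + R c) ≤ b c := by
    intro c
    simp only [Pi.sub_apply, Pi.neg_apply, hψ0, sub_self]
    constructor <;> linarith [htest c]
  intro t ht c
  have key := (box_bootstrap hderD hpos hrate htest' t ht).2 c
  simpa only [Pi.sub_apply, hψ0, sub_self, sub_zero] using key

/-! ### The assembled step theorem -/

/-- **ONE STEP OF THE PSEUDO-FLOW AGAINST THE TAYLOR POLYNOMIAL OF THE EXACT FLOW** (the analytic content of
§format tests (1)–(2)): under the a priori test (`|Q y y|_c + Δ_c ≤ M_c` on the box, margins `h·M`), the jet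
bound `|T y (p+1)|_c ≤ J_c` on the box and the linear bootstrap test for `b`, the pseudo-trajectory satisfies
`|z t c − Σ_{k≤p} T (z 0) k c · t^k| ≤ J_c t^{p+1} + t·(Lm b + R)_c` on `[0,h]` (so `≤ lag_c + b_c` at `t = h`),
and it lies in the a priori box throughout.  Exact flow from the library's rough-enclosure existence theorem,
remainder from `abs_sub_taylor_le_of_mem_Icc`. [folklore] -/
theorem abs_pseudo_sub_taylor_le (Q : (ι → ℝ) →ₗ[ℝ] (ι → ℝ) →ₗ[ℝ] ι → ℝ)
    {T : (ι → ℝ) → ℕ → ι → ℝ} (hT0 : ∀ x, T x 0 = x)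
    (hTs : ∀ x (k : ℕ) c, ((k : ℝ) + 1) * T x (k + 1) c =
      ∑ i ∈ Finset.range (k + 1), Q (T x i) (T x (k - i)) c)
    {z z' : ℝ → ι → ℝ} {h : ℝ} (hh : 0 ≤ h)
    (hder : ∀ s ∈ Icc (0:ℝ) h, HasDerivWithinAt z (z' s) (Icc 0 h) s)
    {lo hi Δ M : ι → ℝ} (hΔ : ∀ c, 0 ≤ Δ c)
    (hdist : ∀ s ∈ Icc (0:ℝ) h, z s ∈ Icc lo hi → ∀ c, |z' s c - Q (z s) (z s) c| ≤ Δ c)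
    (hQ : ∀ y ∈ Icc lo hi, ∀ c, |Q y y c| + Δ c ≤ M c) (hM : ∀ c, 0 < M c)
    (htest : ∀ c, lo c + h * M c ≤ z 0 c ∧ z 0 c + h * M c ≤ hi c)
    {p : ℕ} {J : ι → ℝ} (hJ : ∀ y ∈ Icc lo hi, ∀ c, |T y (p + 1) c| ≤ J c)
    {Lm : ι → ι → ℝ} (hLm : ∀ c c', 0 ≤ Lm c c')
    (hLip : ∀ y ∈ Icc lo hi, ∀ y' ∈ Icc lo hi, ∀ c,
      |Q y y c - Q y' y' c| ≤ ∑ c', Lm c c' * |y c' - y' c'|)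
    {b : ι → ℝ} (hpos : ∀ c, 0 < ∑ c', Lm c c' * b c' + Δ c)
    (hb : ∀ c, h * (∑ c', Lm c c' * b c' + Δ c) ≤ b c) :
    ∀ t ∈ Icc (0:ℝ) h, z t ∈ Icc lo hi ∧ ∀ c,
      |z t c - ∑ k ∈ Finset.range (p + 1), T (z 0) k c * t ^ k| ≤
        J c * t ^ (p + 1) + t * (∑ c', Lm c c' * b c' + Δ c) := by
  -- the pseudo-trajectory stays in the box
  have hz := pseudo_mem_Icc_of_aprioriTest Q hder hdist hQ hM htest
  -- the exact solution from `z 0` exists on `[0,h]` and stays in the box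
  have hx₀ : z 0 ∈ Icc lo hi := (hz 0 (left_mem_Icc.2 hh)).1
  obtain ⟨ψ, hψ0, hψ, hψbox⟩ := exists_sol_mem_Icc_of_roughEnclosure Q hx₀ hh
    (roughEnclosure_of_aprioriTest Q hΔ hQ htest)
  -- Lagrange remainder of the exact solution, and the bootstrap for the difference
  have htaylor := abs_sub_taylor_le_of_mem_Icc Q hT0 hTs hψ hψbox (p := p) hJ
  have hdiff := abs_pseudo_sub_sol_le Q hder hψ hψ0 (fun s hs => (hz s hs).1) hψbox
    (fun s hs c => hdist s hs (hz s hs).1 c) hLm hLip hpos hb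
  intro t ht
  refine ⟨(hz t ht).1, fun c => ?_⟩
  have h1 := htaylor t ht c
  have h2 := hdiff t ht c
  rw [hψ0] at h1
  have e : z t c - ∑ k ∈ Finset.range (p + 1), T (z 0) k c * t ^ k
      = (z t c - ψ t c) + (ψ t c - ∑ k ∈ Finset.range (p + 1), T (z 0) k c * t ^ k) := by ring
  rw [e]
  exact (abs_add_le _ _).trans (by linarith)


end Summit.NavierStokesRegularity.NavierStokesRegularity.Cruxes.RelayFrontStep.PhaseI

end
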